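import Mathlib
import Literature.Computability.AlgebraicComplexity.GroupTheoreticMatMul
import Literature.Computability.AlgebraicComplexity.LaserMethodTypes
import Literature.Computability.AlgebraicComplexity.MultinomialEntropy

set_option linter.dupNamespace false

/-!
# Full-class STPP families of a tiling thin chart give asymmetric thin designs at every slack

Stub `stub_classDesigns` of the line `tame-charts` for the crux
`Summit.MatrixMultiplication.MatrixMultiplication.Theses.ThinBlockAlpha.BoundedExponentThird`.

A chart over a finite abelian group `Z` assigns to every symbol `x : Fin k` three finite sets
`SA x, SB x, SC x ⊆ Z`; write `a_x, b_x, c_x` for their sizes, `q_x = a_x c_x`, `Q = ∑ q_x`,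
`P = ∏ q_x ^ q_x`.  Hypotheses: the differences `SC x − SA x` cover `Z` (so `|Z| ≤ Q`), some
`q_x ≥ 2` (so `P ≥ 2`), thinness `P ≤ (∏ b_x^{q_x})^6`, and every full type class of rows of
composition `m • q` (length `n = m Q`) is an `IsSTPP` family of product blocks in `Fin n → Z`.
Conclusion: for every slack `η > 0` an asymmetric thin design of exponent `≤ ℓ`.

Proof (method of types): the blocks over a row of type `m • q` have sizes `N₁ = (∏ a^q)^m`,
`M = (∏ b^q)^m`, `N₂ = (∏ c^q)^m`, so `N₁ N₂ = P^m ≤ M^6`; the class has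
`L = binom(n; m • q) ≥ Q^n / ((n+1)^k P^m)` members (`one_le_card_pow_mul_typeClassMass_self`), and
`(n+1)^k = (mQ+1)^k ≤ (P^η)^m` for `m` large (polynomial versus exponential growth), whence
`|Z^n| ≤ Q^n ≤ L · (P^m)^{1+η}`.
-/

namespace Summit.MatrixMultiplication.MatrixMultiplication.Theorems.BoundedExponentThird.TameCharts

open Literature.Computability.AlgebraicComplexity
open scoped BigOperators

/-- Polynomial versus exponential growth: for `r > 1` some `m ≥ 1` has `(m Q + 1)^k ≤ r^m`. -/
private theorem stub_classDesigns_growth (k Q : ℕ) {r : ℝ} (hr : 1 < r) :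
    ∃ m : ℕ, 1 ≤ m ∧ (((m * Q + 1 : ℕ) : ℝ)) ^ k ≤ r ^ m := by
  have h := tendsto_pow_const_div_const_pow_of_one_lt k hr
  have hQ1 : (0 : ℝ) < ((Q : ℝ) + 1) ^ k := by positivity
  have hc : (0 : ℝ) < 1 / ((Q : ℝ) + 1) ^ k := by positivity
  have h' : ∀ᶠ n : ℕ in Filter.atTop, (n : ℝ) ^ k / r ^ n < 1 / ((Q : ℝ) + 1) ^ k :=
    h.eventually (gt_mem_nhds hc)
  obtain ⟨N, hN⟩ := Filter.eventually_atTop.1 h'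
  obtain ⟨m, hmN, hm1⟩ : ∃ m : ℕ, N ≤ m ∧ 1 ≤ m := ⟨max N 1, le_max_left _ _, le_max_right _ _⟩
  refine ⟨m, hm1, ?_⟩
  have hm1' : (1 : ℝ) ≤ (m : ℝ) := by exact_mod_cast hm1
  have hrm : 0 < r ^ m := pow_pos (by linarith) _
  have h1 := hN m hmN
  rw [div_lt_div_iff₀ hrm hQ1, one_mul] at h1
  have h2 : (((m * Q + 1 : ℕ) : ℝ)) ≤ (m : ℝ) * ((Q : ℝ) + 1) := by
    have e : (m : ℝ) * ((Q : ℝ) + 1) = (m : ℝ) * Q + m := by ring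
    rw [e]
    push_cast
    linarith
  calc (((m * Q + 1 : ℕ) : ℝ)) ^ k ≤ ((m : ℝ) * ((Q : ℝ) + 1)) ^ k :=
        pow_le_pow_left₀ (by positivity) h2 k
    _ = (m : ℝ) ^ k * ((Q : ℝ) + 1) ^ k := mul_pow _ _ _
    _ ≤ r ^ m := h1.le

/-- The exponent of a power group `Z^n` divides (hence is at most) the exponent of `Z`. -/
private theorem stub_classDesigns_exponent_fun_le {Z : Type} [AddCommGroup Z] [Fintype Z] (n : ℕ) :
    AddMonoid.exponent (Fin n → Z) ≤ AddMonoid.exponent Z := by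
  refine AddMonoid.exponent_min' _ (AddMonoid.exponent_pos.2 AddMonoid.ExponentExists.of_finite)
    fun g => ?_
  ext l
  simp [AddMonoid.exponent_nsmul_eq_zero]

/-- Cover: if the differences `c - a`, `a ∈ SA x`, `c ∈ SC x`, exhaust `Z`, then
`|Z| ≤ ∑_x |SA x| |SC x|`. -/
private theorem stub_classDesigns_card_le_sum {Z : Type} [AddCommGroup Z] [Fintype Z] {k : ℕ}
    (SA SC : Fin k → Finset Z) (hcov : ∀ g : Z, ∃ x, ∃ a ∈ SA x, ∃ c ∈ SC x, c - a = g) :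
    Fintype.card Z ≤ ∑ x, (SA x).card * (SC x).card := by
  classical
  have h : (Finset.univ : Finset Z) ⊆
      (Finset.univ.sigma fun x => SA x ×ˢ SC x).image fun p => p.2.2 - p.2.1 := by
    intro g _
    obtain ⟨x, a, ha, c, hc, rfl⟩ := hcov g
    exact Finset.mem_image.2 ⟨⟨x, a, c⟩,
      Finset.mem_sigma.2 ⟨Finset.mem_univ _, Finset.mem_product.2 ⟨ha, hc⟩⟩, rfl⟩
  calc Fintype.card Z = (Finset.univ : Finset Z).card := Finset.card_univ.symm
    _ ≤ ((Finset.univ.sigma fun x => SA x ×ˢ SC x).image fun p => p.2.2 - p.2.1).card :=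
        Finset.card_le_card h
    _ ≤ (Finset.univ.sigma fun x => SA x ×ˢ SC x).card := Finset.card_image_le
    _ = ∑ x, (SA x).card * (SC x).card := by
        rw [Finset.card_sigma]
        exact Finset.sum_congr rfl fun x _ => Finset.card_product _ _

/-- Fatness: `∏ q^q ≥ 2` as soon as one `q_x ≥ 2` (all factors are `≥ 1`, `0^0 = 1`). -/
private theorem stub_classDesigns_two_le_prod {k : ℕ} (q : Fin k → ℕ) (hfat : ∃ x, 2 ≤ q x) :
    2 ≤ ∏ x, q x ^ q x := by
  obtain ⟨x₀, hx₀⟩ := hfat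
  have h1 : ∀ x ∈ (Finset.univ : Finset (Fin k)), 1 ≤ q x ^ q x := by
    intro x _
    rcases Nat.eq_zero_or_pos (q x) with h | h
    · simp [h]
    · exact Nat.one_le_pow _ _ h
  calc 2 ≤ q x₀ := hx₀
    _ ≤ q x₀ ^ q x₀ := Nat.le_self_pow (by omega) _
    _ ≤ ∏ x, q x ^ q x := Finset.single_le_prod' h1 (Finset.mem_univ x₀)

/-- Cardinality of a product block over a row of composition `m • q`. -/
private theorem stub_classDesigns_card_block {Z : Type} {k n m : ℕ} (S : Fin k → Finset Z)
    (q : Fin k → ℕ) (w : Fin n → Fin k) (hw : letterCount w = fun x => m * q x) :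
    (Fintype.piFinset fun c => S (w c)).card = (∏ x, (S x).card ^ q x) ^ m := by
  rw [Fintype.card_piFinset, prod_apply_eq_prod_pow_letterCount (fun x => (S x).card) w, hw,
    ← Finset.prod_pow]
  refine Finset.prod_congr rfl fun x _ => ?_
  rw [← pow_mul, mul_comm]

/-- The mass of the class of `μ = m • q` under its own law: `∏ (μ_x/n)^{μ_x} = P^m / Q^n` with
`n = m Q`, `P = ∏ q^q`. -/
private theorem stub_classDesigns_mass_eq {k : ℕ} (q μ : Fin k → ℕ) {m Q n : ℕ} (hm : m ≠ 0)
    (hQ : ∑ x, q x = Q) (hμ : ∀ x, μ x = m * q x) (hn : n = m * Q) :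
    ∏ x, ((μ x : ℝ) / n) ^ (μ x) = ((∏ x, q x ^ q x : ℕ) : ℝ) ^ m / (Q : ℝ) ^ n := by
  have hm' : (m : ℝ) ≠ 0 := by exact_mod_cast hm
  have h1 : ∀ x, ((μ x : ℝ) / n) ^ (μ x) = (q x : ℝ) ^ (m * q x) / (Q : ℝ) ^ (m * q x) := by
    intro x
    rw [hμ, hn]
    push_cast
    rw [mul_div_mul_left _ _ hm', div_pow]
  have h2 : ∏ x, (q x : ℝ) ^ (m * q x) = (∏ x, (q x : ℝ) ^ q x) ^ m := by
    rw [← Finset.prod_pow]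
    refine Finset.prod_congr rfl fun x _ => ?_
    rw [← pow_mul, mul_comm]
  rw [Finset.prod_congr rfl fun x _ => h1 x, Finset.prod_div_distrib, h2,
    Finset.prod_pow_eq_pow_sum, ← Finset.mul_sum, hQ, ← hn]
  push_cast
  rfl

/-- Method of types: `Q^n ≤ (n+1)^k · |T(m • q)| · P^m` for `n = m Q`. -/
private theorem stub_classDesigns_types_bound {k : ℕ} (q μ : Fin k → ℕ) {m Q n : ℕ} (hm : m ≠ 0)
    (hQ : ∑ x, q x = Q) (hQpos : 0 < Q) (hμ : ∀ x, μ x = m * q x) (hn : n = m * Q) :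
    (Q : ℝ) ^ n ≤ ((n : ℝ) + 1) ^ k * ((typeClass n μ).card : ℝ) *
      ((∏ x, q x ^ q x : ℕ) : ℝ) ^ m := by
  have hsum : ∑ x, μ x = n := by
    rw [Finset.sum_congr rfl fun x _ => hμ x, ← Finset.mul_sum, hQ, hn]
  have h := one_le_card_pow_mul_typeClassMass_self μ hsum
  rw [Fintype.card_fin, ← card_typeClass_eq_multinomial n μ hsum,
    stub_classDesigns_mass_eq q μ hm hQ hμ hn] at h
  have hQn : (0 : ℝ) < (Q : ℝ) ^ n := by positivity
  have h' : (1 : ℝ) ≤ ((n : ℝ) + 1) ^ k * ((typeClass n μ).card : ℝ) *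
      ((∏ x, q x ^ q x : ℕ) : ℝ) ^ m / (Q : ℝ) ^ n := by
    calc (1 : ℝ) ≤ _ := h
      _ = _ := by ring
  exact (one_le_div hQn).1 h'

/-- **Stub `stub_classDesigns`** (method of types: full-class designs at every slack).  Given a
chart `(SA, SB, SC)` over a finite abelian group `Z` of exponent `≤ ℓ` whose differences
`SC x − SA x` cover `Z`, with a fat symbol, thin (`∏ q^q ≤ ∏ b^{6q}`), and all of whose full type
classes of rows are `IsSTPP` families of product blocks, every slack `η > 0` admits an asymmetric
thin design: an `IsSTPP` family in `H = (Fin n → Z)` with uniform block sizes `N₁, M, N₂`,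
`2 ≤ N₁ N₂`, `(N₁ N₂)^{1/3} ≤ M²` and `|H| ≤ L (N₁ N₂)^{1+η}`. -/
theorem stub_classDesigns (ℓ : ℕ) (Z : Type) [AddCommGroup Z] [Fintype Z] (k : ℕ)
    (SA SB SC : Fin k → Finset Z) (hexp : AddMonoid.exponent Z ≤ ℓ)
    (hP : (∀ g : Z, ∃ x, ∃ a ∈ SA x, ∃ c ∈ SC x, c - a = g) ∧
      (∀ x y, ∀ a ∈ SA x, ∀ c ∈ SC x, ∀ a' ∈ SA y, ∀ c' ∈ SC y, c - a = c' - a' → x = y))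
    (hfat : ∃ x, 2 ≤ (SA x).card * (SC x).card)
    (hthin : ∏ x, ((SA x).card * (SC x).card) ^ ((SA x).card * (SC x).card) ≤
      ∏ x, (SB x).card ^ (6 * ((SA x).card * (SC x).card)))
    (hclass : ∀ (m n L : ℕ) (row : Fin L → Fin n → Fin k), Function.Injective row →
      (∀ i x, (Finset.univ.filter fun c => row i c = x).card = m * ((SA x).card * (SC x).card)) →
      IsSTPP (fun i => Fintype.piFinset fun c => SA (row i c))
        (fun i => Fintype.piFinset fun c => SB (row i c))
        (fun i => Fintype.piFinset fun c => SC (row i c)))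
    (η : ℝ) (hη : 0 < η) :
    ∃ (H : Type) (_ : AddCommGroup H) (_ : Fintype H) (L N₁ M N₂ : ℕ) (A B C : Fin L → Finset H),
      AddMonoid.exponent H ≤ ℓ ∧ IsSTPP A B C ∧
      (∀ i, (A i).card = N₁ ∧ (B i).card = M ∧ (C i).card = N₂) ∧ 2 ≤ N₁ * N₂ ∧
      ((N₁ * N₂ : ℕ) : ℝ) ^ (1 / 3 : ℝ) ≤ (M : ℝ) ^ 2 ∧
      (Fintype.card H : ℝ) ≤ L * ((N₁ * N₂ : ℕ) : ℝ) ^ (1 + η) := by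
  -- the piece sizes `q x = a_x c_x`, their sum `Q` and the growth base `P = ∏ q^q`
  obtain ⟨q, hq⟩ : ∃ q : Fin k → ℕ, ∀ x, (SA x).card * (SC x).card = q x := ⟨_, fun _ => rfl⟩
  simp only [hq] at hfat hthin hclass
  obtain ⟨Q, hQ⟩ : ∃ Q : ℕ, ∑ x, q x = Q := ⟨_, rfl⟩
  obtain ⟨P, hPq⟩ : ∃ P : ℕ, ∏ x, q x ^ q x = P := ⟨_, rfl⟩
  -- (1) cover: `|Z| ≤ Q`
  have hZQ : Fintype.card Z ≤ Q := by
    have h := stub_classDesigns_card_le_sum SA SC hP.1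
    simp only [hq, hQ] at h
    exact h
  -- (2) fatness: `2 ≤ P`, `0 < Q`
  obtain ⟨x₀, hx₀⟩ := hfat
  have hP2 : 2 ≤ P := hPq ▸ stub_classDesigns_two_le_prod q ⟨x₀, hx₀⟩
  have hQpos : 0 < Q := by
    rw [← hQ]
    exact lt_of_lt_of_le (by omega) (Finset.single_le_sum (fun x _ => Nat.zero_le (q x))
      (Finset.mem_univ x₀))
  -- (3) thinness: `P ≤ MB ^ 6`
  obtain ⟨MB, hMB⟩ : ∃ MB : ℕ, ∏ x, (SB x).card ^ q x = MB := ⟨_, rfl⟩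
  have hPMB : P ≤ MB ^ 6 := by
    rw [← hPq, ← hMB, ← Finset.prod_pow]
    refine hthin.trans (le_of_eq (Finset.prod_congr rfl fun x _ => ?_))
    rw [pow_mul']
  -- the outer block sizes
  obtain ⟨PA, hPA⟩ : ∃ PA : ℕ, ∏ x, (SA x).card ^ q x = PA := ⟨_, rfl⟩
  obtain ⟨PC, hPC⟩ : ∃ PC : ℕ, ∏ x, (SC x).card ^ q x = PC := ⟨_, rfl⟩
  have hPAC : PA * PC = P := by
    rw [← hPA, ← hPC, ← hPq, ← Finset.prod_mul_distrib]
    refine Finset.prod_congr rfl fun x _ => ?_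
    rw [← mul_pow, hq]
  -- (4) growth: choose the dilation `m`
  have hP0 : (0 : ℝ) ≤ (P : ℝ) := Nat.cast_nonneg _
  have hP1 : (1 : ℝ) < (P : ℝ) := by
    have : 1 < P := by omega
    exact_mod_cast this
  have hr : (1 : ℝ) < (P : ℝ) ^ η := Real.one_lt_rpow hP1 hη
  obtain ⟨m, hm1, hgrowth⟩ := stub_classDesigns_growth k Q hr
  have hm0 : m ≠ 0 := by omega
  -- the full class of composition `m • q`
  obtain ⟨n, hn⟩ : ∃ n : ℕ, n = m * Q := ⟨_, rfl⟩
  obtain ⟨μ, hμ⟩ : ∃ μ : Fin k → ℕ, ∀ x, μ x = m * q x := ⟨_, fun _ => rfl⟩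
  obtain ⟨T, hT⟩ : ∃ T : Finset (Fin n → Fin k), T = typeClass n μ := ⟨_, rfl⟩
  obtain ⟨row, hrowT, hinj⟩ : ∃ row : Fin T.card → Fin n → Fin k,
      (∀ i, row i ∈ T) ∧ Function.Injective row :=
    ⟨fun i => (T.equivFin.symm i).1, fun i => (T.equivFin.symm i).2,
      Subtype.val_injective.comp T.equivFin.symm.injective⟩
  have htypLC : ∀ i, letterCount (row i) = fun x => m * q x := fun i =>
    (mem_typeClass.1 (hT ▸ hrowT i)).trans (funext hμ)
  have htyp : ∀ i x, (Finset.univ.filter fun c => row i c = x).card = m * q x := fun i x => by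
    rw [← letterCount_apply, htypLC i]
  have hSTPP := hclass m n T.card row hinj htyp
  have hNN : PA ^ m * PC ^ m = P ^ m := by rw [← mul_pow, hPAC]
  -- the witnesses
  refine ⟨Fin n → Z, inferInstance, inferInstance, T.card, PA ^ m, MB ^ m, PC ^ m,
    fun i => Fintype.piFinset fun c => SA (row i c),
    fun i => Fintype.piFinset fun c => SB (row i c),
    fun i => Fintype.piFinset fun c => SC (row i c), ?_, hSTPP, fun i => ⟨?_, ?_, ?_⟩, ?_, ?_, ?_⟩
  · exact (stub_classDesigns_exponent_fun_le n).trans hexp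
  · rw [← hPA]; exact stub_classDesigns_card_block SA q (row i) (htypLC i)
  · rw [← hMB]; exact stub_classDesigns_card_block SB q (row i) (htypLC i)
  · rw [← hPC]; exact stub_classDesigns_card_block SC q (row i) (htypLC i)
  · -- `2 ≤ N₁ N₂ = P ^ m`
    rw [hNN]
    calc 2 ≤ P := hP2
      _ = P ^ 1 := (pow_one P).symm
      _ ≤ P ^ m := Nat.pow_le_pow_right (by omega) hm1
  · -- thinness: `(P^m)^{1/3} ≤ (MB^m)^2` from `P ≤ MB^6`
    rw [hNN]
    have h6 : ((P ^ m : ℕ) : ℝ) ≤ (((MB ^ m : ℕ) : ℝ) ^ 2) ^ 3 := by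
      have : P ^ m ≤ ((MB ^ m) ^ 2) ^ 3 := by
        calc P ^ m ≤ (MB ^ 6) ^ m := Nat.pow_le_pow_left hPMB m
          _ = ((MB ^ m) ^ 2) ^ 3 := by ring
      exact_mod_cast this
    calc ((P ^ m : ℕ) : ℝ) ^ (1 / 3 : ℝ) ≤ ((((MB ^ m : ℕ) : ℝ) ^ 2) ^ 3) ^ (1 / 3 : ℝ) :=
          Real.rpow_le_rpow (Nat.cast_nonneg _) h6 (by norm_num)
      _ = ((MB ^ m : ℕ) : ℝ) ^ 2 := by
          rw [one_div]
          exact Real.pow_rpow_inv_natCast (by positivity) (by norm_num)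
  · -- packing: `|Z|^n ≤ Q^n ≤ (n+1)^k L P^m ≤ L (P^m)^{1+η}`
    rw [hNN, Fintype.card_fun, Fintype.card_fin]
    have htypes := stub_classDesigns_types_bound (k := k) q μ hm0 hQ hQpos hμ hn
    rw [hPq, ← hT] at htypes
    have hgrow : ((n : ℝ) + 1) ^ k ≤ ((P : ℝ) ^ η) ^ m := by
      have e : ((n : ℝ) + 1) = ((m * Q + 1 : ℕ) : ℝ) := by rw [hn]; push_cast; ring
      rw [e]
      exact hgrowth
    have hPm : (0 : ℝ) < (P : ℝ) ^ m := by positivity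
    have e2 : ((P : ℝ) ^ η) ^ m = ((P : ℝ) ^ m) ^ η := by
      rw [← Real.rpow_mul_natCast hP0, mul_comm, Real.rpow_natCast_mul hP0]
    have hle : ((n : ℝ) + 1) ^ k ≤ ((P : ℝ) ^ m) ^ η := hgrow.trans_eq e2
    calc ((Fintype.card Z ^ n : ℕ) : ℝ) ≤ ((Q ^ n : ℕ) : ℝ) := by
          exact_mod_cast Nat.pow_le_pow_left hZQ n
      _ = (Q : ℝ) ^ n := by push_cast; ring
      _ ≤ ((n : ℝ) + 1) ^ k * (T.card : ℝ) * (P : ℝ) ^ m := htypes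
      _ ≤ ((P : ℝ) ^ m) ^ η * (T.card : ℝ) * (P : ℝ) ^ m :=
          mul_le_mul_of_nonneg_right (mul_le_mul_of_nonneg_right hle (Nat.cast_nonneg _)) hPm.le
      _ = (T.card : ℝ) * ((P ^ m : ℕ) : ℝ) ^ (1 + η) := by
          push_cast
          rw [Real.rpow_add hPm, Real.rpow_one]
          ring

end Summit.MatrixMultiplication.MatrixMultiplication.Theorems.BoundedExponentThird.TameCharts
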